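import Mathlib.Analysis.InnerProductSpace.Dual
import Mathlib.Analysis.Calculus.Gradient.Basic
import Mathlib.Analysis.Calculus.ContDiff.Basic
import Mathlib.Analysis.SpecialFunctions.SmoothTransition
import Mathlib.Analysis.SpecificLimits.Basic
import HarnessLib

/-!
# Seifert's algebraic models: preliminaries for the level-set isotopy

Topic `Literature/Topology/FourManifolds` (third rung of the proof of the named fact
`Literature.Topology.FourManifolds.Seifert1936_algebraicModel`, `SeifertAlgebraicModels.lean`).
**Everything in this file is proved; no named fact is introduced.**

The "transversality" step of Akbulut–King, *Topology of Real Algebraic Sets* (1992), Ch. II,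
proof of Thm. 2.8.2 ("By transversality, the zeroes `X` of `λ` are a manifold isotopic to `M`",
PDF p. 72) is, for `V = ℝⁿ`, the classical stability of a compact regular level set under a
`C¹`-small perturbation of the function, realised by the flow of the time-dependent vector field
`X_t = -(g₁ - g) ∇g_t / ‖∇g_t‖²`, `g_t = g + t (g₁ - g)` (Thom's isotopy lemma in its simplest
form; cf. Hirsch, *Differential Topology* (1976), Ch. 8 §1).  This file supplies three small
ingredients of that construction (`SeifertAlgebraicModelsLevelIsotopy.lean`):

* `Literature.Topology.FourManifolds.exists_dualSymm_clm` — the Riesz map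
  `(E →L[ℝ] ℝ) → E` of a real inner product space as an honest `ℝ`-linear continuous map (so
  that `x ↦ ∇g(x)` is visibly smooth when `g` is);
* `Literature.Topology.FourManifolds.exists_contDiff_eq_inv_of_le` — a smooth function on `ℝ`
  equal to `s ↦ 1/s` on `[c, ∞)` (`c > 0`), used to write `1/‖∇g_t‖²` as a globally smooth
  expression;
* `Literature.Topology.FourManifolds.exists_forall_abs_le_imp_le_of_isCompact` — **a regular
  compact level has a uniformly regular neighbourhood**: if `{|g| ≤ α}` is compact and the
  continuous `φ` is positive on `g⁻¹(0)`, then `φ ≥ c > 0` on some `{|g| ≤ β}`, `0 < β ≤ α`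
  (Cantor's intersection theorem for the compact sets `{|g| ≤ α/(k+1), φ ≤ 1/(k+1)}`).

## References

* S. Akbulut, H. King, *Topology of Real Algebraic Sets*, MSRI Publ. 25, Springer (1992), Ch. II,
  proof of Thm. 2.8.2 (PDF p. 72). [AkbulutKing1992]
* M. W. Hirsch, *Differential Topology*, GTM 33, Springer (1976), Ch. 8 §1. [HirschDT1976]
-/

open scoped Topology ContDiff
open Function Set Filter

noncomputable section

namespace Literature.Topology.FourManifolds

/-! ### The Riesz map as a real-linear continuous map -/

/-- **The inverse Riesz isomorphism is `ℝ`-linear and continuous**: on a real inner product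
space there is a continuous linear map `L : (E →L[ℝ] ℝ) →L[ℝ] E` with
`L φ = (toDual ℝ E)⁻¹ φ`, i.e. `⟪L φ, v⟫ = φ v` (Mathlib's `InnerProductSpace.toDual` is packaged
as a conjugate-linear isometry, which for `ℝ` is linear). [folklore] -/
theorem exists_dualSymm_clm (E : Type*) [NormedAddCommGroup E] [InnerProductSpace ℝ E]
    [CompleteSpace E] :
    ∃ L : (E →L[ℝ] ℝ) →L[ℝ] E, ∀ φ : E →L[ℝ] ℝ, L φ = (InnerProductSpace.toDual ℝ E).symm φ := by
  refine ⟨{ toFun := fun φ => (InnerProductSpace.toDual ℝ E).symm φ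
            map_add' := fun a b => map_add _ a b
            map_smul' := fun c a => by simp
            cont := (InnerProductSpace.toDual ℝ E).symm.continuous }, fun φ => rfl⟩

/-! ### A smooth reciprocal away from zero -/

/-- **A globally smooth function equal to `1/s` for `s ≥ c`** (`c > 0`):
`ψ(s) = θ(s) / (θ(s) s + 1 - θ(s))` with `θ` a smooth step from `0` (for `s ≤ c/2`) to `1`
(for `s ≥ c`); the denominator is everywhere positive. [folklore] -/
theorem exists_contDiff_eq_inv_of_le {c : ℝ} (hc : 0 < c) :
    ∃ ψ : ℝ → ℝ, ContDiff ℝ ∞ ψ ∧ ∀ s, c ≤ s → ψ s = s⁻¹ := by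
  set θ : ℝ → ℝ := fun s => Real.smoothTransition ((s - c / 2) / (c / 2)) with hθ_def
  have hθ : ContDiff ℝ ∞ θ :=
    Real.smoothTransition.contDiff.comp ((contDiff_id.sub contDiff_const).div_const _)
  have hθ0 : ∀ s, s ≤ c / 2 → θ s = 0 := fun s hs =>
    Real.smoothTransition.zero_of_nonpos
      (div_nonpos_of_nonpos_of_nonneg (by linarith) (by positivity))
  have hθ1 : ∀ s, c ≤ s → θ s = 1 := fun s hs =>
    Real.smoothTransition.one_of_one_le ((one_le_div (by positivity)).2 (by linarith))
  set d : ℝ → ℝ := fun s => θ s * s + (1 - θ s) with hd_def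
  have hd : ∀ s, 0 < d s := by
    intro s
    rcases le_or_gt s (c / 2) with hs | hs
    · simp [hd_def, hθ0 s hs]
    · have h0 : 0 ≤ θ s := Real.smoothTransition.nonneg _
      have h1 : θ s ≤ 1 := Real.smoothTransition.le_one _
      have hs0 : 0 < s := by linarith
      change 0 < θ s * s + (1 - θ s)
      rcases h0.eq_or_lt with h | h
      · rw [← h]; norm_num
      · nlinarith
  have hdC : ContDiff ℝ ∞ d := (hθ.mul contDiff_id).add (contDiff_const.sub hθ)
  refine ⟨fun s => θ s / d s, hθ.div hdC fun s => (hd s).ne', fun s hs => ?_⟩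
  change θ s / (θ s * s + (1 - θ s)) = s⁻¹
  rw [hθ1 s hs]
  simp

/-! ### A uniformly regular neighbourhood of a compact regular level -/

/-- **A regular compact level has a uniformly regular neighbourhood.** Let `g, φ : X → ℝ` be
continuous, `{x | |g x| ≤ α}` compact (`α > 0`) and `φ > 0` on the level `g⁻¹(0)`. Then there
are `0 < β ≤ α` and `c > 0` with `φ x ≥ c` whenever `|g x| ≤ β` (apply Cantor's intersection
theorem, `IsCompact.elim_directed_family_closed`, to the decreasing closed sets
`{|g| ≤ α/(k+1)} ∩ {φ ≤ 1/(k+1)}`, whose intersection with the compact set is empty).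
[folklore] -/
theorem exists_forall_abs_le_imp_le_of_isCompact {X : Type*} [TopologicalSpace X]
    {g φ : X → ℝ} (hg : Continuous g) (hφ : Continuous φ) {α : ℝ} (hα : 0 < α)
    (hK : IsCompact {x | |g x| ≤ α}) (hpos : ∀ x, g x = 0 → 0 < φ x) :
    ∃ β c : ℝ, 0 < β ∧ β ≤ α ∧ 0 < c ∧ ∀ x, |g x| ≤ β → c ≤ φ x := by
  set t : ℕ → Set X := fun k =>
    {x | |g x| ≤ α * (1 / ((k : ℝ) + 1)) ∧ φ x ≤ 1 / ((k : ℝ) + 1)} with ht_def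
  have htc : ∀ k, IsClosed (t k) := fun k =>
    (isClosed_le (continuous_abs.comp hg) continuous_const).inter (isClosed_le hφ continuous_const)
  have hdt : Directed (· ⊇ ·) t := by
    refine directed_of_isDirected_le fun i j hij => ?_
    have hij' : (1 : ℝ) / ((j : ℝ) + 1) ≤ 1 / ((i : ℝ) + 1) :=
      one_div_le_one_div_of_le (by positivity) (by exact_mod_cast Nat.succ_le_succ hij)
    intro x hx
    exact ⟨hx.1.trans (mul_le_mul_of_nonneg_left hij' hα.le), hx.2.trans hij'⟩
  have hst : {x | |g x| ≤ α} ∩ ⋂ k, t k = ∅ := by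
    refine Set.eq_empty_iff_forall_notMem.2 fun x hx => ?_
    have hx2 : ∀ k, x ∈ t k := fun k => Set.mem_iInter.1 hx.2 k
    have hlim : Tendsto (fun k : ℕ => (1 : ℝ) / ((k : ℝ) + 1)) atTop (𝓝 0) :=
      tendsto_one_div_add_atTop_nhds_zero_nat
    have hg0 : g x = 0 := by
      have h1 : |g x| ≤ α * 0 :=
        ge_of_tendsto' (hlim.const_mul α) fun k => (hx2 k).1
      rw [mul_zero] at h1
      exact abs_nonpos_iff.1 h1
    have hφ0 : φ x ≤ 0 := ge_of_tendsto' hlim fun k => (hx2 k).2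
    exact absurd (hpos x hg0) (not_lt.2 hφ0)
  obtain ⟨k, hk⟩ := hK.elim_directed_family_closed t htc hst hdt
  refine ⟨α * (1 / ((k : ℝ) + 1)), 1 / ((k : ℝ) + 1), by positivity, ?_, by positivity,
    fun x hx => ?_⟩
  · have : (1 : ℝ) / ((k : ℝ) + 1) ≤ 1 := by
      rw [div_le_one (by positivity)]; linarith [(k.cast_nonneg : (0 : ℝ) ≤ k)]
    simpa using mul_le_mul_of_nonneg_left this hα.le
  · by_contra h
    push Not at h
    have hxK : x ∈ {x | |g x| ≤ α} := by
      have : (1 : ℝ) / ((k : ℝ) + 1) ≤ 1 := by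
        rw [div_le_one (by positivity)]; linarith [(k.cast_nonneg : (0 : ℝ) ≤ k)]
      exact hx.trans (by simpa using mul_le_mul_of_nonneg_left this hα.le)
    have hxt : x ∈ t k := ⟨hx, h.le⟩
    have : x ∈ ({x | |g x| ≤ α} ∩ t k) := ⟨hxK, hxt⟩
    rw [hk] at this
    exact this

end Literature.Topology.FourManifolds
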